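import Literature.NumberTheory.LFunctions.KMVPrimeAveragedDiagOnly
import Literature.NumberTheory.LFunctions.KMVFirstMomentBeyondDiagonal
import HarnessLib

/-!
# The prime-averaged squeeze on the SECOND defect alone, and the value crux from it
(Kowalski–Michel–VanderKam 2000, §6 p. 19: the second-moment display; Thm. 6.1 / §7: `P = X²`)

Topic `Literature/NumberTheory/LFunctions` (cell landau-siegel §D, family route `PrimeLevelFamEdge`,
crux K_B = `BeyondDiagonalBeatsQuarter`, stmt-Parity-20343; D-0130 line `prime-averaged-squeeze`).
PROVED, 0 named facts. Companion of `KMVPrimeAveragedDiagOnly` (p523798), whose squeeze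
(`T₂_eq_zero_of_primeAveragedDiagOnly`) takes the card's full predicate `PrimeAveragedDiagOnly a b`
(first AND second defects, every admissible `P`, every even-or-odd `Q`). The value crux consumes far
less: only the SECOND defect, only at `(P, Q) = (X², 1)`, and only on some window `(1, b)`; the
first-moment side at `Q = 1` is Bettin's printed twisted first moment (`bettin2017_theorem11_primeLevel`,
p515810), which pins `T₁ = 0` POINTWISE below length `2` (`firstCorrectionVanishes_of_bettin`). This
file re-runs the squeeze on exactly that input.

WHAT IS PROVED.
* §1 `eq_zero_of_goodPrimes_blockAverage` (private, as in p523798) — the abstract squeeze: terms `F q ≥ |t| − C/log q̂(q)` at the good primes, non-empty blocks for unboundedly many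
  `N`, block sums eventually `≤ ε · #block` for every `ε` ⇒ `t = 0`.
* §2 `T₂_eq_zero_of_secondDefect_average` (+ `_of_le_two`, and the first-moment twin
  `T₁_eq_zero_of_firstDefect_average`): under `MomentAsymptotics Δlo Δhi T₁ T₂`, if the SECOND
  defect alone is `o(1)` on average over the good primes of dyadic blocks at `(P, Q, Δ')`, then
  `T₂ Δ' P Q = 0`.
* §3 `secondDefect_average_of_primeAveragedDiagOnly` / `firstDefect_average_…` — the card's `C⁺` on
  `(a, b)` gives both one-defect averages at every `(P, Q)` and `Δ' ∈ (a, b)` (the defects are `≥ 0`).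
* §4 `beatsQuarter_window_of_secondDefect_average_X_sq` — for a window `(1, Δ]` with MA-consistent
  `(T₁, T₂)`: second-defect averages at `(X², 1)` on `(1, b)` plus `T₁(·, X², 1) = 0` on
  `(1, min Δ 2)` give the `(a', b')`-shaped conclusion of the value crux (`a' = 1`,
  `b' = min Δ (min b 2)`, `P = X²`, value `Δ'/(2(1+Δ'))`); and
  `beatsQuarter_of_bettin_of_secondDefect_average_X_sq` — the same with the `T₁ = 0` input discharged
  by Bettin's printed fact and the diagonal main term of the profile `X²` (`MollifierMainTermAsymp
  (X ^ 2)`, landed Summits-side p526832): literally `bettin2017_theorem11_primeLevel →` the body of the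
  route's K_B (rev 3), in the KMV vocabulary.

WHAT THIS IS NOT: no claim that any second-defect average is small on any window reaching `Δ' ≥ 1`
(registry famE-02: OPEN IN PRINT at a fixed level; the prime-AVERAGED display beyond the diagonal is
not in our holdings either — Iwaniec–Sarnak 2000 average over ALL levels, acq-11417); a REDUCTION, it
eliminates nothing. «The programme SEARCHES and TYPES; no claim about Landau–Siegel zeros, Theorems 1–2
of arXiv:2211.02515 or a repaired Margin232 until a kernel theorem says so.»

## References

* [KowalskiMichelVanderKam2000] E. Kowalski, P. Michel, J. VanderKam, J. reine angew. Math. 526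
  (2000) 1–34: §2 p. 7 (`M ∉ ℤ`), §6 p. 19 (the two displays), Thm. 6.1 (32), §7 p. 21 (`P = X²`).
  [held: paper:doi-10-1515-crll-2000-074 p0007, p0019–p0021]
* [Bettin2017] S. Bettin, Thm. 1.1 (prime level, weight 2, no shift). [held: paper:arxiv-1605.02440 p0003]
-/

noncomputable section

namespace Literature.NumberTheory.LFunctions.KMV2000

open Polynomial Finset
open scoped Real

/-! ## §1. The abstract squeeze over blocks of good primes -/

/-- **Abstract squeeze.** If `F q ≥ |t| − C/log q̂(q)` (with `1 ≤ log q̂(q)`) at every good prime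
`q ≥ q₀` for the exponent `Δ'`, good primes for `Δ'` are unbounded, and the block sums of `F` over
`goodPrimes Δ' N` are eventually `≤ ε · #goodPrimes Δ' N` for every `ε > 0`, then `t = 0` (an
`ε`-average of terms `≥ |t| − ε` over a NON-EMPTY block forces `|t| ≤ 2ε`). Public form of the engine
of `T₂_eq_zero_of_primeAveragedDiagOnly` (p523798); kept private like its original (an uncited averaging
lemma). [folklore] -/
private theorem eq_zero_of_goodPrimes_blockAverage {Δ' t C : ℝ} {q₀ : ℕ} {F : ℕ → ℝ} (hC : 0 ≤ C)
    (hF : ∀ (q : ℕ) [NeZero q], q.Prime → q₀ ≤ q → (∀ n : ℕ, (n : ℝ) ≠ qhat q ^ Δ') →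
      1 ≤ Real.log (qhat q) ∧ |t| - C / Real.log (qhat q) ≤ F q)
    (hgood : GoodPrimesUnbounded Δ')
    (hav : ∀ ε : ℝ, 0 < ε → ∃ N₀ : ℕ, ∀ N : ℕ, N₀ ≤ N →
      ∑ q ∈ goodPrimes Δ' N, F q ≤ ε * (goodPrimes Δ' N).card) : t = 0 := by
  by_contra hne
  set δ : ℝ := |t| with hδ
  have hδpos : 0 < δ := abs_pos.2 hne
  obtain ⟨N₀, hN₀⟩ := hav (δ / 4) (by positivity)
  -- threshold beyond which `C / log q̂ ≤ δ/4`
  set B : ℝ := 4 * C / δ + 1 with hB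
  obtain ⟨N₁, hN₁⟩ := exists_log_qhat_ge B
  obtain ⟨N, hNge, hNne⟩ := exists_goodPrimes_nonempty hgood (max N₀ (max q₀ N₁))
  have hsum := hN₀ N (le_trans (le_max_left _ _) hNge)
  -- every good prime of the block contributes at least `3δ/4`
  have hterm : ∀ q ∈ goodPrimes Δ' N, 3 * δ / 4 ≤ F q := by
    intro q hq
    rw [mem_goodPrimes_iff] at hq
    obtain ⟨hqN, -, hqp, hqg⟩ := hq
    haveI : NeZero q := ⟨hqp.ne_zero⟩
    have hq₀ : q₀ ≤ q := by
      have := le_trans (le_max_left _ _) (le_trans (le_max_right _ _) hNge); omega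
    have hqN₁ : N₁ ≤ q := by
      have := le_trans (le_max_right _ _) (le_trans (le_max_right _ _) hNge); omega
    obtain ⟨hlg1, hle⟩ := hF q hqp hq₀ (fun n ↦ by simpa [qhat] using hqg n)
    have hlgB : B ≤ Real.log (qhat q) := hN₁ q hqN₁
    have hlgpos : 0 < Real.log (qhat q) := by linarith
    have hCle : C / Real.log (qhat q) ≤ δ / 4 := by
      rw [div_le_iff₀ hlgpos]
      have h4 : C ≤ δ / 4 * B := by
        have : δ / 4 * (4 * C / δ + 1) = C + δ / 4 := by field_simp
        rw [hB, this]
        linarith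
      exact h4.trans (mul_le_mul_of_nonneg_left hlgB (by positivity))
    linarith
  have hcard : (0 : ℝ) < (goodPrimes Δ' N).card := by exact_mod_cast hNne.card_pos
  have hlow : 3 * δ / 4 * (goodPrimes Δ' N).card ≤ ∑ q ∈ goodPrimes Δ' N, F q := by
    have := Finset.card_nsmul_le_sum (goodPrimes Δ' N) _ (3 * δ / 4) hterm
    rwa [nsmul_eq_mul, mul_comm] at this
  nlinarith [hlow.trans hsum]

/-! ## §2. The squeeze on ONE defect -/

/-- **The squeeze, second defect only.** If the moment asymptotics hold on `(Δlo, Δhi]` with extra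
main terms `(T₁, T₂)` and, at `(P, Q, Δ')` with `Δ' ∈ (Δlo, Δhi]`, `Δ' > 0`, good primes unbounded,
the SECOND defect is `o(1)` on average over the good primes of dyadic blocks — for every `ε > 0`,
eventually in `N`, `Σ_{q ∈ goodPrimes Δ' N} secondDefect P Q Δ' q ≤ ε · #goodPrimes Δ' N` — then
`T₂ Δ' P Q = 0`. (The second display makes every such defect `≥ |T₂ Δ' P Q| − O(1/log q̂)`.)
[cite: KowalskiMichelVanderKam2000, §6 p. 19 (second-moment display)] -/
theorem T₂_eq_zero_of_secondDefect_average {Δlo Δhi : ℝ} {T₁ T₂ : ℝ → ℝ[X] → ℝ[X] → ℝ}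
    (h : MomentAsymptotics Δlo Δhi T₁ T₂) {P Q : ℝ[X]} (hP : Admissible P) (hQ : IsEvenOrOdd Q)
    {Δ' : ℝ} (h1 : Δlo < Δ') (h2 : Δ' ≤ Δhi) (hΔ' : 0 < Δ') (hgood : GoodPrimesUnbounded Δ')
    (hav : ∀ ε : ℝ, 0 < ε → ∃ N₀ : ℕ, ∀ N : ℕ, N₀ ≤ N →
      ∑ q ∈ goodPrimes Δ' N, secondDefect P Q Δ' q ≤ ε * (goodPrimes Δ' N).card) :
    T₂ Δ' P Q = 0 := by
  obtain ⟨C, hC0, q₀, hC⟩ := abs_T₂_sub_le_secondDefect h hP hQ h1 h2 hΔ'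
  exact eq_zero_of_goodPrimes_blockAverage (q₀ := q₀) (F := fun q ↦ secondDefect P Q Δ' q) hC0
    (fun q _ hq hq₀ hg ↦ hC q hq hq₀ hg) hgood hav

/-- The same with KMV's guard discharged on `(0, 2]` (`goodPrimesUnbounded_of_lt_two` / `_two`).
[cite: KowalskiMichelVanderKam2000, §6 p. 19 (second-moment display); §2 p. 7 (M ∉ ℤ)] -/
theorem T₂_eq_zero_of_secondDefect_average_of_le_two {Δlo Δhi : ℝ}
    {T₁ T₂ : ℝ → ℝ[X] → ℝ[X] → ℝ} (h : MomentAsymptotics Δlo Δhi T₁ T₂) {P Q : ℝ[X]}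
    (hP : Admissible P) (hQ : IsEvenOrOdd Q) {Δ' : ℝ} (h1 : Δlo < Δ') (h2 : Δ' ≤ Δhi)
    (hΔ' : 0 < Δ') (hΔ2 : Δ' ≤ 2)
    (hav : ∀ ε : ℝ, 0 < ε → ∃ N₀ : ℕ, ∀ N : ℕ, N₀ ≤ N →
      ∑ q ∈ goodPrimes Δ' N, secondDefect P Q Δ' q ≤ ε * (goodPrimes Δ' N).card) :
    T₂ Δ' P Q = 0 := by
  have hgood : GoodPrimesUnbounded Δ' := by
    rcases eq_or_lt_of_le hΔ2 with rfl | hlt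
    · exact goodPrimesUnbounded_two
    · exact goodPrimesUnbounded_of_lt_two hΔ' hlt
  exact T₂_eq_zero_of_secondDefect_average h hP hQ h1 h2 hΔ' hgood hav

/-- **The squeeze, first defect only** (twin): a first defect that is `o(1)` on average over the good
primes of dyadic blocks at `(P, Q, Δ')` pins `T₁ Δ' P Q = 0`.
[cite: KowalskiMichelVanderKam2000, §6 p. 19 (first-moment display)] -/
theorem T₁_eq_zero_of_firstDefect_average {Δlo Δhi : ℝ} {T₁ T₂ : ℝ → ℝ[X] → ℝ[X] → ℝ}
    (h : MomentAsymptotics Δlo Δhi T₁ T₂) {P Q : ℝ[X]} (hP : Admissible P) (hQ : IsEvenOrOdd Q)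
    {Δ' : ℝ} (h1 : Δlo < Δ') (h2 : Δ' ≤ Δhi) (hΔ' : 0 < Δ') (hgood : GoodPrimesUnbounded Δ')
    (hav : ∀ ε : ℝ, 0 < ε → ∃ N₀ : ℕ, ∀ N : ℕ, N₀ ≤ N →
      ∑ q ∈ goodPrimes Δ' N, firstDefect P Q Δ' q ≤ ε * (goodPrimes Δ' N).card) :
    T₁ Δ' P Q = 0 := by
  obtain ⟨C, hC0, q₀, hC⟩ := abs_T₁_sub_le_firstDefect h hP hQ h1 h2 hΔ'
  exact eq_zero_of_goodPrimes_blockAverage (q₀ := q₀) (F := fun q ↦ firstDefect P Q Δ' q) hC0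
    (fun q _ hq hq₀ hg ↦ hC q hq hq₀ hg) hgood hav

/-! ## §3. The card's `C⁺` gives each one-defect average -/

/-- `PrimeAveragedDiagOnly a b` (the card's `C⁺`) gives the SECOND-defect average at every admissible
`P`, even-or-odd `Q` and `Δ' ∈ (a, b)` (drop the non-negative first defect).
[cite: KowalskiMichelVanderKam2000, §6 p. 19 (second-moment display)] -/
theorem secondDefect_average_of_primeAveragedDiagOnly {a b : ℝ} (hav : PrimeAveragedDiagOnly a b)
    {P Q : ℝ[X]} (hP : Admissible P) (hQ : IsEvenOrOdd Q) {Δ' : ℝ} (ha : a < Δ') (hb : Δ' < b) :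
    ∀ ε : ℝ, 0 < ε → ∃ N₀ : ℕ, ∀ N : ℕ, N₀ ≤ N →
      ∑ q ∈ goodPrimes Δ' N, secondDefect P Q Δ' q ≤ ε * (goodPrimes Δ' N).card := by
  intro ε hε
  obtain ⟨N₀, hN₀⟩ := hav P Q hP hQ Δ' ha hb ε hε
  refine ⟨N₀, fun N hN ↦ le_trans (Finset.sum_le_sum fun q _ ↦ ?_) (hN₀ N hN)⟩
  exact le_add_of_nonneg_left (firstDefect_nonneg P Q Δ' q)

/-- `PrimeAveragedDiagOnly a b` gives the FIRST-defect average likewise.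
[cite: KowalskiMichelVanderKam2000, §6 p. 19 (first-moment display)] -/
theorem firstDefect_average_of_primeAveragedDiagOnly {a b : ℝ} (hav : PrimeAveragedDiagOnly a b)
    {P Q : ℝ[X]} (hP : Admissible P) (hQ : IsEvenOrOdd Q) {Δ' : ℝ} (ha : a < Δ') (hb : Δ' < b) :
    ∀ ε : ℝ, 0 < ε → ∃ N₀ : ℕ, ∀ N : ℕ, N₀ ≤ N →
      ∑ q ∈ goodPrimes Δ' N, firstDefect P Q Δ' q ≤ ε * (goodPrimes Δ' N).card := by
  intro ε hε
  obtain ⟨N₀, hN₀⟩ := hav P Q hP hQ Δ' ha hb ε hε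
  refine ⟨N₀, fun N hN ↦ le_trans (Finset.sum_le_sum fun q _ ↦ ?_) (hN₀ N hN)⟩
  exact le_add_of_nonneg_right (secondDefect_nonneg P Q Δ' q)

/-! ## §4. The value crux from the second-defect average at `(X², 1)` plus `T₁ = 0` -/

/-- **The value crux from one averaged display.** Let `(1, Δ]` be a window with MA-consistent
`(T₁, T₂)`. If the SECOND defect at `(P, Q) = (X², 1)` is `o(1)` on average over the good primes of
dyadic blocks for every `Δ' ∈ (1, b)` (`b > 1`), and the first correction of `X²` vanishes on
`(1, min Δ 2)`, then on `(a', b') = (1, min Δ (min b 2))` — so `1 ≤ a' < b' ≤ Δ`, `a' < 3/2` — the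
profile `P = X²` has Cauchy–Schwarz value `(lin + T₁)²/(2(second + T₂)) = Δ'/(2(1+Δ')) > ¼`:
`T₂ = 0` by the squeeze, `T₁ = 0` by hypothesis, then `ratio_one_X_sq` / `quarter_lt_envelope'`.
[cite: KowalskiMichelVanderKam2000, Thm. 6.1 (32); §6 p. 19; §2 footnote 2] -/
theorem beatsQuarter_window_of_secondDefect_average_X_sq {b : ℝ} (hb : 1 < b)
    (hav : ∀ Δ' : ℝ, 1 < Δ' → Δ' < b → ∀ ε : ℝ, 0 < ε → ∃ N₀ : ℕ, ∀ N : ℕ, N₀ ≤ N →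
      ∑ q ∈ goodPrimes Δ' N, secondDefect (X ^ 2) 1 Δ' q ≤ ε * (goodPrimes Δ' N).card)
    {Δ : ℝ} (hΔ : 1 < Δ) {T₁ T₂ : ℝ → ℝ[X] → ℝ[X] → ℝ} (hMA : MomentAsymptotics 1 Δ T₁ T₂)
    (hT₁ : ∀ Δ' : ℝ, 1 < Δ' → Δ' < min Δ 2 → T₁ Δ' (X ^ 2) 1 = 0) :
    ∃ a' b' : ℝ, 1 ≤ a' ∧ a' < b' ∧ b' ≤ Δ ∧ a' < 3 / 2 ∧ ∃ P : ℝ[X], Admissible P ∧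
      ∀ Δ' : ℝ, a' < Δ' → Δ' < b' →
        1 / 4 < (linForm Δ' P 1 + T₁ Δ' P 1) ^ 2 /
          (2 * (secondMomentForm Δ' P 1 + T₂ Δ' P 1)) := by
  refine ⟨1, min Δ (min b 2), le_rfl, lt_min hΔ (lt_min hb (by norm_num)), min_le_left _ _,
    by norm_num, X ^ 2, admissible_X_sq, fun Δ' h1 h2 ↦ ?_⟩
  have hΔ'Δ : Δ' ≤ Δ := h2.le.trans (min_le_left _ _)
  have hΔ'b : Δ' < b := lt_of_lt_of_le h2 ((min_le_right _ _).trans (min_le_left _ _))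
  have hΔ'2 : Δ' < 2 := lt_of_lt_of_le h2 ((min_le_right _ _).trans (min_le_right _ _))
  have e1 : T₁ Δ' (X ^ 2) 1 = 0 :=
    hT₁ Δ' h1 (lt_min (lt_of_lt_of_le h2 (min_le_left _ _)) hΔ'2)
  have e2 : T₂ Δ' (X ^ 2) 1 = 0 :=
    T₂_eq_zero_of_secondDefect_average_of_le_two hMA admissible_X_sq isEvenOrOdd_one h1 hΔ'Δ
      (by linarith) hΔ'2.le (hav Δ' h1 hΔ'b)
  rw [e1, e2, add_zero, add_zero]
  have h := ratio_one_X_sq (Δ := Δ') (by linarith)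
  unfold ratio at h
  rw [h]
  exact quarter_lt_envelope' h1

/-- **`Bettin →` the body of the value crux, from one averaged display.** GIVEN Bettin's printed
twisted first moment at prime level (`bettin2017_theorem11_primeLevel`, which with the diagonal main
term of the profile `X²`, `MollifierMainTermAsymp (X ^ 2)`, pins `T₁(Δ', X², 1) = 0` on `(1, min Δ 2)`,
`firstCorrectionVanishes_of_bettin`): if the second defect at `(X², 1)` is `o(1)` on average over the
good primes of dyadic blocks on some window `(1, b)`, then for EVERY window `(1, Δ]` and EVERY
MA-consistent `(T₁, T₂)` some admissible profile beats `¼` on an open sub-window `(a', b') ⊆ [1, Δ]`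
with `a' < 3/2` — the statement of the route's crux `BeyondDiagonalBeatsQuarter` (rev 3) in the KMV
vocabulary. A REDUCTION: the averaged display is not in print on any window reaching `Δ' ≥ 1`.
[cite: KowalskiMichelVanderKam2000, Thm. 6.1 (32); §6 p. 19] [cite: Bettin2017, Thm. 1.1] -/
theorem beatsQuarter_of_bettin_of_secondDefect_average_X_sq (hB : bettin2017_theorem11_primeLevel)
    (hS : MollifierMainTermAsymp (X ^ 2)) {b : ℝ} (hb : 1 < b)
    (hav : ∀ Δ' : ℝ, 1 < Δ' → Δ' < b → ∀ ε : ℝ, 0 < ε → ∃ N₀ : ℕ, ∀ N : ℕ, N₀ ≤ N →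
      ∑ q ∈ goodPrimes Δ' N, secondDefect (X ^ 2) 1 Δ' q ≤ ε * (goodPrimes Δ' N).card) :
    ∀ Δ : ℝ, 1 < Δ → ∀ T₁ T₂ : ℝ → ℝ[X] → ℝ[X] → ℝ, MomentAsymptotics 1 Δ T₁ T₂ →
      ∃ a' b' : ℝ, 1 ≤ a' ∧ a' < b' ∧ b' ≤ Δ ∧ a' < 3 / 2 ∧ ∃ P : ℝ[X], Admissible P ∧
        ∀ Δ' : ℝ, a' < Δ' → Δ' < b' →
          1 / 4 < (linForm Δ' P 1 + T₁ Δ' P 1) ^ 2 /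
            (2 * (secondMomentForm Δ' P 1 + T₂ Δ' P 1)) :=
  fun Δ hΔ T₁ T₂ hMA ↦ beatsQuarter_window_of_secondDefect_average_X_sq hb hav hΔ hMA
    (firstCorrectionVanishes_of_bettin hB hS Δ hΔ T₁ T₂ hMA)

/-- **`C⁺` on `(a, b)` with `a ≤ 1 < b`, together with Bettin's fact and the `X²` main term, gives
the body of the value crux** — the route of p523798's `beatsQuarter_ab_of_primeAveragedDiagOnly`
through the second defect only (the first-defect clauses of `C⁺` are not consumed: Bettin replaces
them at `Q = 1`). [cite: KowalskiMichelVanderKam2000, Thm. 6.1 (32); §6 p. 19] [cite: Bettin2017, Thm. 1.1] -/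
theorem beatsQuarter_of_bettin_of_primeAveragedDiagOnly (hB : bettin2017_theorem11_primeLevel)
    (hS : MollifierMainTermAsymp (X ^ 2)) {a b : ℝ} (ha : a ≤ 1) (hb : 1 < b)
    (hav : PrimeAveragedDiagOnly a b) :
    ∀ Δ : ℝ, 1 < Δ → ∀ T₁ T₂ : ℝ → ℝ[X] → ℝ[X] → ℝ, MomentAsymptotics 1 Δ T₁ T₂ →
      ∃ a' b' : ℝ, 1 ≤ a' ∧ a' < b' ∧ b' ≤ Δ ∧ a' < 3 / 2 ∧ ∃ P : ℝ[X], Admissible P ∧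
        ∀ Δ' : ℝ, a' < Δ' → Δ' < b' →
          1 / 4 < (linForm Δ' P 1 + T₁ Δ' P 1) ^ 2 /
            (2 * (secondMomentForm Δ' P 1 + T₂ Δ' P 1)) :=
  beatsQuarter_of_bettin_of_secondDefect_average_X_sq hB hS hb fun _ h1 h2 ↦
    secondDefect_average_of_primeAveragedDiagOnly hav admissible_X_sq isEvenOrOdd_one
      (lt_of_le_of_lt ha h1) h2

end Literature.NumberTheory.LFunctions.KMV2000
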